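import Summits.HubbardSuperconductivity.HubbardSuperconductivity.Theses.KkFloor
import Summits.HubbardSuperconductivity.HubbardSuperconductivity.Theorems.KkBandLift.Negative.NotKkBandLiftOfThermalShell
import Summits.HubbardSuperconductivity.HubbardSuperconductivity.Theorems.KkBandLift.Negative.ThermalShellWitness
import HarnessLib

/-!
# Route `KkFloor`: refutation of the crux `KkBandLift` (stmt-HubbardSuperconductivity-10402)

`KkBandLift` (Kramers–Kronig band lift): `∃ U > 0, δ ∈ (0,½), ε > 0, 0 < Y₁ < Y₂, L₀` such that for
every even `L ≥ L₀`, every `y ∈ [Y₁,Y₂]` and every eigenvector `φ` of `H_L + iy L⁻²Δ_d†Δ_d` in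
`szSector (2⌊(1-δ)L²/2⌋) 0`, `Re λ ≥ minEnergyOn H_L (sector) + εL²`.  FALSE: the composition
`kkBandLift_false_of_thermalShellWitness` (fixed-height floor `finiteXFloor` + bookkeeping,
`Negative/NotKkBandLiftOfThermalShell.lean`, after `Cruxes/KkBandLift/StrategistNegation.lean`)
applied to the unconditional witness `thermalShellWitness_of_mem_Ioo`
(`Negative/ThermalShellWitness.lean`).  Witness arithmetic: at the band's `(U,δ)` put
`c = ε(Y₂-Y₁)/(4π(1+Y₂²))`, `L = 2(max L₀ L₁ + 1)`; the floor at `x = 1` gives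
`εL²(Y₂-Y₁)/(1+Y₂²) ≤ π((Re⟨φ,Hφ⟩-E₀) + L⁻²Re⟨φ,Δ_d†Δ_dφ⟩) ≤ 2πcL²`, i.e. `4πcL² ≤ 2πcL²`.

CLASS `refuted-substantive`: the band / shelf / window is demanded of ALL eigenvectors of the
pair-penalised pencil in the doped sector, uniformly `Ω(L²)` above the sector ground energy; the
sector always contains unit vectors of energy `≤ E₀ + cL²` with d-wave pair intensity `≤ cL⁴` for
every `c > 0` (thermal shell: Koma–Tasaki decay in the canonical-sector Gibbs state at `β = 4/c`,
entropy budget, ground vector of the budget operator), and the fixed-height Kramers–Kronig floor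
(`finiteXFloor`) converts a lift that holds on the whole sector spectrum into
`Ω(L²)` energy-or-pair-order for EVERY unit sector vector — contradiction.  Repairs tried, each still
killed or leaving the route: (i) smaller `ε`, other bands `[Y₁,Y₂]` / thresholds `Y` / windows
`|y| ≤ y₁` — the witness beats every fixed positive constant; (ii) other couplings / fillings — the
witness holds for all `U : ℝ`, all `δ ≥ -1`; (iii) restricting the lift to eigenvectors near the
bottom of the spectrum — then it is no longer the hypothesis `KkFloorTheorem` / the route glue
consume (a planner's restatement, not a repair of this decl).
barrier-candidate: "thermal-shell census" — no spectral statement quantified over all eigenvectors of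
a fixed-sector pair-penalised pencil `H + iyL⁻²Δ†Δ` on the 2D Hubbard torus can carry an `Ω(L²)`
lift, because positive-temperature canonical states have no pair LRO (Koma–Tasaki 1992).

HONEST FRAMING: a DECIDABLE VERDICT (kernel-checked refutation closing a route item), not summit
progress.  Sources: T. Koma, H. Tasaki, Phys. Rev. Lett. 68 (1992) 3248 (Theorem, eq. (2), (3),
footnote [10]); T. Ransford, Potential Theory in the Complex Plane (1995), Thm 6.4.2.
No definitions.
-/

-- the mandated namespace `Summit.<Summit>.<Problem>.Theorems…` repeats `HubbardSuperconductivity`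
-- (single-problem summit, D-0017), which the `dupNamespace` linter flags on every declaration
set_option linter.dupNamespace false

namespace Summit.HubbardSuperconductivity.HubbardSuperconductivity.Theorems

open Summit.HubbardSuperconductivity.HubbardSuperconductivity.Theorems.KkBandLift.Negative
  (kkBandLift_false_of_thermalShellWitness thermalShellWitness_of_mem_Ioo)

/-- Refutes `KkFloor.KkBandLift` [refuted-substantive]: no `(U, δ, ε, [Y₁,Y₂], L₀)` gives an `εL²`
lift of the whole doped-sector spectrum of `H_L + iyL⁻²Δ_d†Δ_d`; witness = the thermal-shell unit
vector at budget `c = ε(Y₂-Y₁)/(4π(1+Y₂²))` on the even side `2(max L₀ L₁ + 1)`, fed to the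
fixed-height Kramers–Kronig floor; no cheap repair (module docstring); barrier-candidate:
thermal-shell census. [folklore] -/
theorem KkFloorKkBandLift_refuted :
    ¬ Summit.HubbardSuperconductivity.HubbardSuperconductivity.Theses.KkFloor.KkBandLift :=
  kkBandLift_false_of_thermalShellWitness fun U δ _ hδ c hc =>
    thermalShellWitness_of_mem_Ioo U δ hδ c hc

end Summit.HubbardSuperconductivity.HubbardSuperconductivity.Theorems
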